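import Summits.Ventures.PercRepro.S2TriangleDegree
import Summits.Ventures.PercRepro.S1SpreadTrianglesCap

/-!
# PercRepro — IN REGIME B A TRIANGLE OF A SPREAD CORE MEETS AT MOST TWO OTHER TRIANGLES (p1, gen 36)

`proofs/P1-S2-CORANK6.md` §4t. p7's S2TriangleDegree shows that on a spread core (lines `≤ 3` points, `hC1`; every set of `≤ 9`
points has nullity `≤ 3`, `h9`) a triangle `T` meets at most THREE other triangles, because a third triangle `F₃ ≠ T` meeting `T`
must lie inside `T ∪ F₁ ∪ F₂` for any two others (`S2.subset_union_of_triangles_meeting`). In REGIME B — no six-point set of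
rank `≤ 3` (`hno`; automatic as soon as there are `≥ 5` triangles, `S1.ncard_triangles_le_four_of_six`) — that containment is
itself impossible: `F₃` then meets `T`, `F₁`, `F₂` in three distinct points `z, y, w`, so `F₃ ⊆ cl {z, y} ⊆ cl (T ∪ F₁)` and
`T ∪ F₁ ∪ F₃` is a six-point set of rank `≤ 3`. Hence **`ncard_triangles_meeting_le_two`**: at most TWO other triangles meet
`T`, **`ncard_triangles_le_three_add_disjoint`**: `#𝒯 ≤ 3 + #{triangles disjoint from T}`, and with `≥ 5` triangles every
triangle has two distinct triangles disjoint from it (**`exists_two_disjoint_triangles_of_five`**) — the hypothesis of the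
two-avoiding-circuits charge of the top `6`-sets through `T` (`S2.ncard_top_six_through_add_le`) at every row `t ≥ 5` of the
spread case, and the pair count `#{sharing pairs} ≤ #𝒯` of the slack-zero structure theorem. The `hfree` / `hns` forms
(`…_of_free`) derive `hC1`, `h9`, `hno` from the e-free core and the spread hypothesis. Nothing about any cell is claimed.
Axioms: standard.
-/

open scoped Matroid

namespace PercRepro

namespace S1

open Set

variable {α : Type}

/-- **In regime B, three distinct triangles `F₁ F₂ F₃ ≠ T` cannot all meet `T`**: p7's containment `F₃ ⊆ T ∪ F₁ ∪ F₂`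
puts `T ∪ F₁ ∪ F₃` (six points) in rank `≤ 3`. -/
theorem not_three_triangles_meeting (M : Matroid α) [M.Finite]
    (hC1 : ∀ L ⊆ M.E, M.eRk L = 2 → L.ncard ≤ 3)
    (h9 : ∀ X ⊆ M.E, X.ncard ≤ 9 → X.encard ≤ M.eRk X + 3)
    (hno : ¬ ∃ W ⊆ M.E, W.ncard = 6 ∧ M.eRk W ≤ 3)
    {T F₁ F₂ F₃ : Set α} (hT : M.IsCircuit T) (hT3 : T.ncard = 3)
    (hF₁ : M.IsCircuit F₁) (hF₁3 : F₁.ncard = 3) (hF₁T : F₁ ≠ T) (hF₁m : ¬ Disjoint F₁ T)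
    (hF₂ : M.IsCircuit F₂) (hF₂3 : F₂.ncard = 3) (hF₂T : F₂ ≠ T) (hF₂m : ¬ Disjoint F₂ T)
    (hF₃ : M.IsCircuit F₃) (hF₃3 : F₃.ncard = 3) (hF₃T : F₃ ≠ T) (hF₃m : ¬ Disjoint F₃ T)
    (h12 : F₁ ≠ F₂) (h13 : F₁ ≠ F₃) (h23 : F₂ ≠ F₃) : False := by
  have hTfin : T.Finite := M.ground_finite.subset hT.subset_ground
  have hF₁fin : F₁.Finite := M.ground_finite.subset hF₁.subset_ground
  have hF₃fin : F₃.Finite := M.ground_finite.subset hF₃.subset_ground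
  have hsub : F₃ ⊆ T ∪ F₁ ∪ F₂ :=
    S2.subset_union_of_triangles_meeting M hC1 h9 hT hT3 hF₁ hF₁3 hF₁T hF₁m hF₂ hF₂3 hF₂T hF₂m hF₃ hF₃3 hF₃T hF₃m h12
  -- the three intersections of `F₃` with `T`, `F₁`, `F₂` are singletons
  obtain ⟨z, hzF₃, hzT⟩ := Set.not_disjoint_iff.1 hF₃m
  have hiT : F₃ ∩ T = {z} := S2.inter_eq_singleton_of_triangles_through M hC1 hF₃ hF₃3 hT hT3 hF₃T hzF₃ hzT
  have hi1 : (F₃ ∩ F₁).ncard ≤ 1 := S2.ncard_inter_le_one_of_triangles M hC1 hF₃ hF₃3 hF₁ hF₁3 (Ne.symm h13)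
  have hi2 : (F₃ ∩ F₂).ncard ≤ 1 := S2.ncard_inter_le_one_of_triangles M hC1 hF₃ hF₃3 hF₂ hF₂3 (Ne.symm h23)
  have hcover : F₃ ⊆ (F₃ ∩ T) ∪ (F₃ ∩ F₁) ∪ (F₃ ∩ F₂) := by
    intro x hx
    rcases hsub hx with (h | h) | h
    · exact Or.inl (Or.inl ⟨hx, h⟩)
    · exact Or.inl (Or.inr ⟨hx, h⟩)
    · exact Or.inr ⟨hx, h⟩
  have hle := Set.ncard_le_ncard hcover
    (((hF₃fin.subset inter_subset_left).union (hF₃fin.subset inter_subset_left)).union (hF₃fin.subset inter_subset_left))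
  have hu1 := Set.ncard_union_le ((F₃ ∩ T) ∪ (F₃ ∩ F₁)) (F₃ ∩ F₂)
  have hu2 := Set.ncard_union_le (F₃ ∩ T) (F₃ ∩ F₁)
  have hiT1 : (F₃ ∩ T).ncard = 1 := by rw [hiT]; exact Set.ncard_singleton z
  have hi1' : (F₃ ∩ F₁).ncard = 1 := by omega
  obtain ⟨y, hy⟩ := Set.ncard_eq_one.1 hi1'
  have hyF₃ : y ∈ F₃ := (show y ∈ F₃ ∩ F₁ by rw [hy]; rfl).1
  have hyF₁ : y ∈ F₁ := (show y ∈ F₃ ∩ F₁ by rw [hy]; rfl).2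
  -- `y ≠ z` and `y ∉ T`, `z ∉ F₁`
  have hyT : y ∉ T := by
    intro hyT
    have : y ∈ F₃ ∩ T := ⟨hyF₃, hyT⟩
    rw [hiT, mem_singleton_iff] at this
    subst this
    -- then `F₃ ⊆ {y} ∪ (F₃ ∩ F₂)` has `≤ 2` points
    have hcover' : F₃ ⊆ {y} ∪ (F₃ ∩ F₂) := by
      intro x hx
      rcases hcover hx with (h | h) | h
      · rw [hiT] at h; exact Or.inl h
      · rw [hy] at h; exact Or.inl h
      · exact Or.inr h
    have := Set.ncard_le_ncard hcover' ((Set.finite_singleton y).union (hF₃fin.subset inter_subset_left))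
    have hu := Set.ncard_union_le ({y} : Set α) (F₃ ∩ F₂)
    rw [Set.ncard_singleton] at hu
    omega
  have hyz : y ≠ z := fun h => hyT (h ▸ hzT)
  have hzy : z ≠ y := Ne.symm hyz
  -- the third point `w` of `F₃` lies outside `T ∪ F₁`
  obtain ⟨w, hwF₃, hw⟩ : ∃ w ∈ F₃, w ∉ T ∪ F₁ := by
    by_contra hcon
    push Not at hcon
    have hcover' : F₃ ⊆ {z, y} := by
      intro x hx
      rcases hcon x hx with h | h
      · have : x ∈ F₃ ∩ T := ⟨hx, h⟩
        rw [hiT, mem_singleton_iff] at this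
        exact Or.inl this
      · have : x ∈ F₃ ∩ F₁ := ⟨hx, h⟩
        rw [hy, mem_singleton_iff] at this
        exact Or.inr (mem_singleton_iff.2 this)
    have := Set.ncard_le_ncard hcover' (toFinite _)
    rw [Set.ncard_pair hzy] at this
    · omega
  -- the six-point set `W = T ∪ F₁ ∪ F₃` of rank `≤ 3`
  have hF₃cl : F₃ ⊆ M.closure (T ∪ F₁) := by
    have h1 : F₃ ⊆ M.closure {z, y} := tri_subset_closure_pair M hF₃ hF₃3 hzF₃ hyF₃ (Ne.symm hyz)
    have h2 : ({z, y} : Set α) ⊆ T ∪ F₁ := by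
      intro x hx
      rcases hx with rfl | rfl
      · exact Or.inl hzT
      · exact Or.inr hyF₁
    exact h1.trans (M.closure_subset_closure h2)
  have hrkW : M.eRk (T ∪ F₁ ∪ F₃) ≤ 3 := by
    rw [eRk_union_eq_of_subset_closure M hF₃cl]
    -- `F₁ ⊆ cl (T ∪ {y})` with `y ∈ F₁ \ T`, so `rank (T ∪ F₁) ≤ rank T + 1 = 3`
    obtain ⟨x, hxF₁, hxT⟩ := Set.not_disjoint_iff.1 hF₁m
    have hxy : x ≠ y := fun h => hyT (h ▸ hxT)
    have hF₁cl : F₁ ⊆ M.closure (insert y T) := by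
      have h1 : F₁ ⊆ M.closure {x, y} := tri_subset_closure_pair M hF₁ hF₁3 hxF₁ hyF₁ hxy
      have h2 : ({x, y} : Set α) ⊆ insert y T := by
        intro u hu
        rcases hu with rfl | rfl
        · exact Or.inr hxT
        · exact Or.inl rfl
      exact h1.trans (M.closure_subset_closure h2)
    have h1 : M.eRk (T ∪ F₁) ≤ M.eRk (insert y T ∪ F₁) := M.eRk_mono (union_subset_union_left _ (subset_insert _ _))
    rw [eRk_union_eq_of_subset_closure M hF₁cl] at h1
    have h2 := M.eRk_insert_le_add_one y T
    rw [eRk_eq_two_of_tri M hT hT3] at h2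
    exact h1.trans (h2.trans (by norm_num))
  have hcardW : (T ∪ F₁ ∪ F₃).ncard = 6 := by
    have e1 : (T ∪ F₁).ncard = 5 := by
      have h := S2.ncard_sdiff_eq_two_of_triangles_meeting M hC1 hT hT3 hF₁ hF₁3 hF₁T hF₁m
      have hu : T ∪ F₁ = T ∪ (F₁ \ T) := by ext u; simp only [mem_union, mem_sdiff]; tauto
      rw [hu, Set.ncard_union_eq disjoint_sdiff_right hTfin (hF₁fin.subset sdiff_subset), hT3, h]
    have hF₃eq : F₃ = {z, y, w} := by
      apply Set.eq_of_subset_of_ncard_le _ _ (toFinite _)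
      · intro x hx
        rcases hcover hx with (h | h) | h
        · rw [hiT] at h; exact Or.inl h
        · rw [hy] at h; exact Or.inr (Or.inl h)
        · -- a point of `F₃ ∩ F₂` is `z`, `y` or `w`: it is `w` unless it lies in `T ∪ F₁`
          by_cases hxT : x ∈ T
          · have : x ∈ F₃ ∩ T := ⟨hx, hxT⟩
            rw [hiT] at this; exact Or.inl this
          by_cases hxF₁ : x ∈ F₁
          · have : x ∈ F₃ ∩ F₁ := ⟨hx, hxF₁⟩
            rw [hy] at this; exact Or.inr (Or.inl this)
          -- `x, w ∈ F₃ ∩ F₂`, both outside `T ∪ F₁`, and `|F₃ ∩ F₂| ≤ 1`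
          have hwF₂ : w ∈ F₃ ∩ F₂ := by
            rcases hcover hwF₃ with (h' | h') | h'
            · exact absurd (Or.inl h'.2) hw
            · exact absurd (Or.inr h'.2) hw
            · exact h'
          have hx2 : x ∈ F₃ ∩ F₂ := h
          have hxw : x = w := by
            by_contra hne
            have : 2 ≤ (F₃ ∩ F₂).ncard := by
              have hp : ({x, w} : Set α) ⊆ F₃ ∩ F₂ := by
                intro u hu; rcases hu with rfl | rfl; exact hx2; exact hwF₂
              have := Set.ncard_le_ncard hp (hF₃fin.subset inter_subset_left)
              rwa [Set.ncard_pair hne] at this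
            omega
          exact Or.inr (Or.inr (mem_singleton_iff.2 hxw))
      · rw [hF₃3]
        have hzw : z ≠ w := fun h => hw (Or.inl (h ▸ hzT))
        have hyw : y ≠ w := fun h => hw (Or.inr (h ▸ hyF₁))
        rw [Set.ncard_insert_of_notMem (by simp only [mem_insert_iff, mem_singleton_iff, not_or]; exact ⟨hzy, hzw⟩)
          (toFinite _), Set.ncard_pair hyw]
    have e2 : (T ∪ F₁ ∪ F₃).ncard = (T ∪ F₁).ncard + 1 := by
      have hu : T ∪ F₁ ∪ F₃ = insert w (T ∪ F₁) := by
        rw [hF₃eq]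
        ext u
        simp only [mem_union, mem_insert_iff, mem_singleton_iff]
        constructor
        · rintro ((h | h) | h | h | h)
          · exact Or.inr (Or.inl h)
          · exact Or.inr (Or.inr h)
          · exact Or.inr (Or.inl (h ▸ hzT))
          · exact Or.inr (Or.inr (h ▸ hyF₁))
          · exact Or.inl h
        · rintro (h | h | h)
          · exact Or.inr (Or.inr (Or.inr h))
          · exact Or.inl (Or.inl h)
          · exact Or.inl (Or.inr h)
      rw [hu, Set.ncard_insert_of_notMem hw (hTfin.union hF₁fin)]
    omega
  exact hno ⟨T ∪ F₁ ∪ F₃, union_subset (union_subset hT.subset_ground hF₁.subset_ground) hF₃.subset_ground,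
    hcardW, hrkW⟩

/-- **At most two other triangles meet a triangle `T`** in regime B. -/
theorem ncard_triangles_meeting_le_two (M : Matroid α) [M.Finite]
    (hC1 : ∀ L ⊆ M.E, M.eRk L = 2 → L.ncard ≤ 3)
    (h9 : ∀ X ⊆ M.E, X.ncard ≤ 9 → X.encard ≤ M.eRk X + 3)
    (hno : ¬ ∃ W ⊆ M.E, W.ncard = 6 ∧ M.eRk W ≤ 3)
    {T : Set α} (hT : M.IsCircuit T) (hT3 : T.ncard = 3) :
    {C : Set α | M.IsCircuit C ∧ C.ncard = 3 ∧ C ≠ T ∧ ¬ Disjoint C T}.ncard ≤ 2 := by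
  by_contra hlt
  push Not at hlt
  have hfin : {C : Set α | M.IsCircuit C ∧ C.ncard = 3 ∧ C ≠ T ∧ ¬ Disjoint C T}.Finite :=
    M.ground_finite.finite_subsets.subset (fun C hC => hC.1.subset_ground)
  obtain ⟨F₁, F₂, F₃, h₁, h₂, h₃, h12, h13, h23⟩ := (Set.two_lt_ncard_iff hfin).1 hlt
  exact not_three_triangles_meeting M hC1 h9 hno hT hT3 h₁.1 h₁.2.1 h₁.2.2.1 h₁.2.2.2 h₂.1 h₂.2.1 h₂.2.2.1 h₂.2.2.2
    h₃.1 h₃.2.1 h₃.2.2.1 h₃.2.2.2 h12 h13 h23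

/-- **`#𝒯 ≤ 3 + #{triangles disjoint from T}`** in regime B (every triangle is `T`, meets `T`, or avoids `T`). -/
theorem ncard_triangles_le_three_add_disjoint (M : Matroid α) [M.Finite]
    (hC1 : ∀ L ⊆ M.E, M.eRk L = 2 → L.ncard ≤ 3)
    (h9 : ∀ X ⊆ M.E, X.ncard ≤ 9 → X.encard ≤ M.eRk X + 3)
    (hno : ¬ ∃ W ⊆ M.E, W.ncard = 6 ∧ M.eRk W ≤ 3)
    {T : Set α} (hT : M.IsCircuit T) (hT3 : T.ncard = 3) :
    {C : Set α | M.IsCircuit C ∧ C.ncard = 3}.ncard ≤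
      3 + {C : Set α | M.IsCircuit C ∧ C.ncard = 3 ∧ Disjoint C T}.ncard := by
  classical
  set 𝒯 := {C : Set α | M.IsCircuit C ∧ C.ncard = 3} with h𝒯
  have h𝒯fin : 𝒯.Finite := M.ground_finite.finite_subsets.subset (fun C hC => hC.1.subset_ground)
  set 𝒩 := {C : Set α | M.IsCircuit C ∧ C.ncard = 3 ∧ C ≠ T ∧ ¬ Disjoint C T} with h𝒩
  set 𝒟 := {C : Set α | M.IsCircuit C ∧ C.ncard = 3 ∧ Disjoint C T} with h𝒟
  have h𝒩fin : 𝒩.Finite := h𝒯fin.subset (fun C hC => ⟨hC.1, hC.2.1⟩)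
  have h𝒟fin : 𝒟.Finite := h𝒯fin.subset (fun C hC => ⟨hC.1, hC.2.1⟩)
  have h2 : 𝒩.ncard ≤ 2 := ncard_triangles_meeting_le_two M hC1 h9 hno hT hT3
  have hcover : 𝒯 ⊆ ({T} ∪ 𝒩) ∪ 𝒟 := by
    intro T' hT'
    by_cases hne : T' = T
    · exact Or.inl (Or.inl (Set.mem_singleton_iff.2 hne))
    by_cases hdis : Disjoint T' T
    · exact Or.inr ⟨hT'.1, hT'.2, hdis⟩
    · exact Or.inl (Or.inr ⟨hT'.1, hT'.2, hne, hdis⟩)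
  have hle := Set.ncard_le_ncard hcover (((Set.finite_singleton T).union h𝒩fin).union h𝒟fin)
  have hu1 := Set.ncard_union_le ({T} ∪ 𝒩) 𝒟
  have hu2 := Set.ncard_union_le ({T} : Set (Set α)) 𝒩
  rw [Set.ncard_singleton] at hu2
  omega

/-- **With `≥ 5` triangles, every triangle `T` has two distinct triangles disjoint from it** (regime B): the hypothesis of the
two-avoiding-circuits charge of the top `6`-sets through `T`. -/
theorem exists_two_disjoint_triangles_of_five (M : Matroid α) [M.Finite]
    (hC1 : ∀ L ⊆ M.E, M.eRk L = 2 → L.ncard ≤ 3)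
    (h9 : ∀ X ⊆ M.E, X.ncard ≤ 9 → X.encard ≤ M.eRk X + 3)
    (hno : ¬ ∃ W ⊆ M.E, W.ncard = 6 ∧ M.eRk W ≤ 3)
    (h5 : 5 ≤ {C : Set α | M.IsCircuit C ∧ C.ncard = 3}.ncard)
    {T : Set α} (hT : M.IsCircuit T) (hT3 : T.ncard = 3) :
    ∃ D₁ D₂ : Set α, M.IsCircuit D₁ ∧ D₁.ncard = 3 ∧ M.IsCircuit D₂ ∧ D₂.ncard = 3 ∧ D₁ ≠ D₂ ∧
      Disjoint D₁ T ∧ Disjoint D₂ T := by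
  have h𝒟fin : {C : Set α | M.IsCircuit C ∧ C.ncard = 3 ∧ Disjoint C T}.Finite :=
    M.ground_finite.finite_subsets.subset (fun C hC => hC.1.subset_ground)
  have h3 := ncard_triangles_le_three_add_disjoint M hC1 h9 hno hT hT3
  have h2 : 1 < {C : Set α | M.IsCircuit C ∧ C.ncard = 3 ∧ Disjoint C T}.ncard := by omega
  obtain ⟨D₁, D₂, hD₁, hD₂, hne⟩ := (Set.one_lt_ncard_iff h𝒟fin).1 h2
  exact ⟨D₁, D₂, hD₁.1, hD₁.2.1, hD₂.1, hD₂.2.1, hne, hD₁.2.2, hD₂.2.2⟩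

/-- **Regime B from `≥ 5` triangles**: on a spread e-free core, a six-point set of rank `≤ 3` would contain every triangle, and then
there are at most four (`ncard_triangles_le_four_of_six`). -/
theorem no_six_of_five_le_triangles (M : Matroid α) [M.Finite]
    (hfree : ∀ e ∈ M.E, ∃ A ⊆ M.E \ {e}, e ∉ M.closure A ∧ e ∉ M.closure ((M.E \ {e}) \ A))
    (hns : ¬ ∃ W ⊆ M.E, W.ncard ≤ 9 ∧ W.encard = M.eRk W + 4)
    (h5 : 5 ≤ {C : Set α | M.IsCircuit C ∧ C.ncard = 3}.ncard) :
    ¬ ∃ W ⊆ M.E, W.ncard = 6 ∧ M.eRk W ≤ 3 := by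
  rintro ⟨W, hWE, hW6, hW3⟩
  have := ncard_triangles_le_four_of_six M hfree hWE hW6
    (fun T hT hT3 => tri_subset_of_six M hfree hns hWE hW6 hW3 hT hT3)
  omega

/-- Lines of an e-free core have `≤ 3` points, in p7's form `hC1`. -/
theorem lines_le_three_of_free (M : Matroid α) [M.Finite]
    (hfree : ∀ e ∈ M.E, ∃ A ⊆ M.E \ {e}, e ∉ M.closure A ∧ e ∉ M.closure ((M.E \ {e}) \ A)) :
    ∀ L ⊆ M.E, M.eRk L = 2 → L.ncard ≤ 3 :=
  fun _ hL h2 => ncard_le_three_of_eRk_le_two M hfree hL h2.le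

/-- Spread in p7's form `h9`: every set of `≤ 9` points has nullity `≤ 3` (nullity descent inside a set of nullity `≥ 4`). -/
theorem nullity_le_three_of_spread (M : Matroid α) [M.Finite]
    (hns : ¬ ∃ W ⊆ M.E, W.ncard ≤ 9 ∧ W.encard = M.eRk W + 4) :
    ∀ X ⊆ M.E, X.ncard ≤ 9 → X.encard ≤ M.eRk X + 3 := by
  intro X hX hX9
  by_contra hlt
  push Not at hlt
  have hk : M.eRk X + 4 ≤ X.encard := by
    have := Order.add_one_le_of_lt hlt
    rwa [add_assoc, show (3 : ℕ∞) + 1 = 4 by norm_num] at this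
  obtain ⟨W', hW'X, hW'⟩ := S2.exists_subset_encard_eq_eRk_add M hX 4 hk
  exact hns ⟨W', hW'X.trans hX, (Set.ncard_le_ncard hW'X (M.ground_finite.subset hX)).trans hX9, hW'⟩

/-- **At most two other triangles meet a triangle `T`** on a spread e-free core with `≥ 5` triangles. -/
theorem ncard_triangles_meeting_le_two_of_free (M : Matroid α) [M.Finite]
    (hfree : ∀ e ∈ M.E, ∃ A ⊆ M.E \ {e}, e ∉ M.closure A ∧ e ∉ M.closure ((M.E \ {e}) \ A))
    (hns : ¬ ∃ W ⊆ M.E, W.ncard ≤ 9 ∧ W.encard = M.eRk W + 4)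
    (h5 : 5 ≤ {C : Set α | M.IsCircuit C ∧ C.ncard = 3}.ncard)
    {T : Set α} (hT : M.IsCircuit T) (hT3 : T.ncard = 3) :
    {C : Set α | M.IsCircuit C ∧ C.ncard = 3 ∧ C ≠ T ∧ ¬ Disjoint C T}.ncard ≤ 2 :=
  ncard_triangles_meeting_le_two M (lines_le_three_of_free M hfree) (nullity_le_three_of_spread M hns)
    (no_six_of_five_le_triangles M hfree hns h5) hT hT3

/-- **Two distinct triangles avoiding `T`** on a spread e-free core with `≥ 5` triangles. -/
theorem exists_two_disjoint_triangles_of_free (M : Matroid α) [M.Finite]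
    (hfree : ∀ e ∈ M.E, ∃ A ⊆ M.E \ {e}, e ∉ M.closure A ∧ e ∉ M.closure ((M.E \ {e}) \ A))
    (hns : ¬ ∃ W ⊆ M.E, W.ncard ≤ 9 ∧ W.encard = M.eRk W + 4)
    (h5 : 5 ≤ {C : Set α | M.IsCircuit C ∧ C.ncard = 3}.ncard)
    {T : Set α} (hT : M.IsCircuit T) (hT3 : T.ncard = 3) :
    ∃ D₁ D₂ : Set α, M.IsCircuit D₁ ∧ D₁.ncard = 3 ∧ M.IsCircuit D₂ ∧ D₂.ncard = 3 ∧ D₁ ≠ D₂ ∧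
      Disjoint D₁ T ∧ Disjoint D₂ T :=
  exists_two_disjoint_triangles_of_five M (lines_le_three_of_free M hfree) (nullity_le_three_of_spread M hns)
    (no_six_of_five_le_triangles M hfree hns h5) h5 hT hT3

end S1

end PercRepro
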